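import Summits.CriticalPhenomena.PercolationContinuityZ3.Theorems.PercNearOneGluingNoHeavyLowerTailSunflowerSizeBias
import Summits.CriticalPhenomena.PercolationContinuityZ3.Theorems.PercNearOneGluingNoHeavyLowerTailSunflowerSpectatorTransfer
import Mathlib.Analysis.SpecificLimits.Basic
import HarnessLib
import HarnessLib.Audit

/-!
# `NoHeavyLowerTail` (crux stmt-CriticalPhenomena-4575), abstract sunflower cubic: the two typed size-biased partition lemmas
# COINCIDE — `WeightedPartitionLemma` (ℕ weights, `ZHw`) ↔ `SizeBiasedPartitionIneq` (real weights `≥ 0`, `ZW`)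

Support file (seat `prim-ineq-gen-2` gen 22; `--supports stmt-CriticalPhenomena-4575`).  No `sorry`, nothing asserted about the crux: both sides
are `@[conjecture]` obligations of the tree (`…SunflowerSizeBias`, prove-1 g26; `…SunflowerSpectatorTransfer`, this seat), used only as hypotheses.
This file records that they are ONE conjecture (★_w), so that a proof or refutation of either settles both.

* `Sunflower.ZW_natCast` — `ZW n₁ n₂ n₃ = ZHw n₁ n₂ n₃` for natural weights.
* `Sunflower.ZW_smul` — homogeneity `ZW (t a) (t b) (t c) = t ^ |α| · ZW a b c` (the three block sizes of an ordered 3-partition add up to `|α|`,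
  `card_blocks_eq`).
* `weightedPartitionLemma_of_sizeBiased` (cast) and `sizeBiased_of_weightedPartitionLemma` (homogeneity + the limit `⌊w n⌋₊ / n → w`
  (`tendsto_nat_floor_mul_div_atTop`) + continuity of the polynomial `ZW` along the approximating sequence, `Sunflower.tendsto_ZW`);
  `weightedPartitionLemma_iff_sizeBiased`.
-/

namespace Summit.CriticalPhenomena.PercolationContinuityZ3.Theorems.SunflowerPartition

open Finset Filter Topology

variable {α : Type*} [Fintype α] [DecidableEq α]

/-- The three block sizes of an ordered 3-partition `(q.1, q.2, (q.1 ∪ q.2)ᶜ)` of `α` add up to `|α|`. [folklore] -/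
theorem card_blocks_eq {q : Finset α × Finset α} (hq : q ∈ parts α) :
    q.1.card + q.2.card + ((q.1 ∪ q.2)ᶜ).card = Fintype.card α := by
  unfold parts at hq
  rw [mem_filter] at hq
  rw [← card_union_of_disjoint hq.2, card_compl]
  have h : (q.1 ∪ q.2).card ≤ Fintype.card α := card_le_univ _
  omega

namespace Sunflower

variable (F : Sunflower α)

/-- `ZW` at natural weights is the integer functional `ZHw`. [this work] -/
theorem ZW_natCast (n₁ n₂ n₃ : ℕ) : F.ZW n₁ n₂ n₃ = (F.ZHw n₁ n₂ n₃ : ℝ) := by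
  unfold ZW ZHw
  push_cast
  refine sum_congr rfl fun q _ => ?_
  ring

/-- HOMOGENEITY of the size-biased functional: `ZW (t a) (t b) (t c) = t ^ |α| · ZW a b c`. [this work] -/
theorem ZW_smul (t a b c : ℝ) : F.ZW (t * a) (t * b) (t * c) = t ^ Fintype.card α * F.ZW a b c := by
  unfold ZW
  rw [mul_sum]
  refine sum_congr rfl fun q hq => ?_
  rw [← card_blocks_eq hq, mul_pow, mul_pow, mul_pow]
  ring

/-- `ZW` along three convergent weight sequences converges (it is a polynomial in the weights). [this work] -/
theorem tendsto_ZW {a b c : ℕ → ℝ} {w₁ w₂ w₃ : ℝ} (ha : Tendsto a atTop (𝓝 w₁)) (hb : Tendsto b atTop (𝓝 w₂))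
    (hc : Tendsto c atTop (𝓝 w₃)) : Tendsto (fun n => F.ZW (a n) (b n) (c n)) atTop (𝓝 (F.ZW w₁ w₂ w₃)) := by
  unfold ZW
  refine tendsto_finsetSum _ fun q _ => ?_
  exact (((ha.pow _).mul (hb.pow _)).mul (hc.pow _)).mul tendsto_const_nhds

end Sunflower

/-- `SizeBiasedPartitionIneq → WeightedPartitionLemma` (natural weights are nonnegative reals). [this work] -/
theorem weightedPartitionLemma_of_sizeBiased (h : SizeBiasedPartitionIneq) : WeightedPartitionLemma := by
  intro α _ _ F n₁ n₂ n₃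
  have h' := h α F n₁ n₂ n₃ (Nat.cast_nonneg _) (Nat.cast_nonneg _) (Nat.cast_nonneg _)
  rw [F.ZW_natCast] at h'
  exact_mod_cast h'

/-- `WeightedPartitionLemma → SizeBiasedPartitionIneq`: by homogeneity `ZW (⌊w₁n⌋₊/n, ⌊w₂n⌋₊/n, ⌊w₃n⌋₊/n) = n^{-|α|} · ZHw (⌊w₁n⌋₊, ⌊w₂n⌋₊, ⌊w₃n⌋₊) ≥ 0`,
and `ZW` is continuous along the approximating sequence. [this work] -/
theorem sizeBiased_of_weightedPartitionLemma (h : WeightedPartitionLemma) : SizeBiasedPartitionIneq := by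
  intro α _ _ F w₁ w₂ w₃ h₁ h₂ h₃
  -- the approximants `⌊w n⌋₊ / n → w` (`tendsto_nat_floor_mul_div_atTop` along `Nat.cast`)
  have hlim := F.tendsto_ZW (a := fun n : ℕ => (⌊w₁ * n⌋₊ : ℝ) / n) (b := fun n : ℕ => (⌊w₂ * n⌋₊ : ℝ) / n)
    (c := fun n : ℕ => (⌊w₃ * n⌋₊ : ℝ) / n)
    ((tendsto_nat_floor_mul_div_atTop h₁).comp tendsto_natCast_atTop_atTop)
    ((tendsto_nat_floor_mul_div_atTop h₂).comp tendsto_natCast_atTop_atTop)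
    ((tendsto_nat_floor_mul_div_atTop h₃).comp tendsto_natCast_atTop_atTop)
  refine ge_of_tendsto' hlim fun n => ?_
  have e : ∀ w : ℝ, (⌊w * n⌋₊ : ℝ) / n = (n : ℝ)⁻¹ * (⌊w * n⌋₊ : ℕ) := fun w => by
    rw [div_eq_inv_mul]
  rw [e, e, e, F.ZW_smul, F.ZW_natCast]
  refine mul_nonneg (pow_nonneg (inv_nonneg.2 (Nat.cast_nonneg _)) _) ?_
  exact_mod_cast h α F _ _ _

/-- **The two typed size-biased partition lemmas are equivalent.** [this work] -/
theorem weightedPartitionLemma_iff_sizeBiased : WeightedPartitionLemma ↔ SizeBiasedPartitionIneq :=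
  ⟨sizeBiased_of_weightedPartitionLemma, weightedPartitionLemma_of_sizeBiased⟩

end Summit.CriticalPhenomena.PercolationContinuityZ3.Theorems.SunflowerPartition
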